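import Mathlib.GroupTheory.SpecificGroups.Cyclic
import HarnessLib

/-!
# [IUTchI] Def 6.1 (v): the exponent of an automorphism on the RANK ONE QUOTIENT (prime-index subquotients)

S. Mochizuki, *Inter-universal Teichmüller theory I*, kurims manuscript (May 2020), §6 Definition 6.1 (v)
p. 158: "the Borel subgroup corresponding to the rank one quotient of `Δ_X^{ab} ⊗ 𝔽_l` that gives rise to the
covering `X̲_K → X_K`. In particular, this rank one quotient determines a natural surjective homomorphism
`Aut(𝒟^{⊚±}) ↠ 𝔽_l^⋇` [which may be reconstructed category-theoretically from `𝒟^{⊚±}`!] — whose kernel we denote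
by `Aut_±(𝒟^{⊚±})`" ([IUTchI] Def 6.1 (v) p.158) [claim: Mochizuki2012, status: disputed] (D-0012 claim key,
series status DISPUTED — this file is FINITE GROUP THEORY; nothing of the series is asserted and no side is taken
on [IUTchIII] Cor. 3.12).

## Why (KIT-INSTANCE row D13-P3-v; abc-iut-L5-lead RULINGS #25 (7) / #28 (2); abc-iut-L5-t4 lemma list
03:58:14Z, items (L1) and (L2a/b) in DEF-FREE form; companion `LabelsPlusMinusUnitEquivariant.lean` = (L4) + `𝔽_l^⋇`)

In the Π-avatar with embedded objects (abc-iut-L5-t4 `PiAvatarOrbitCategory`, p419432: `Aut(A/H) = N_A(H)/H`,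
`OrbitCat.autOfNormalizer`, `…_eq_iff`, `exists_eq_autOfNormalizer`) the model global object is `𝒟^{⊚±} = ℬ(Y)⁰`
for `Y = Π_{X̲_K} ≤ X = Π_{X_K} ≤ A = Π_{C_F}`, `Y ⊴ X` of prime index `l` ([IUTchI] Def 3.1 (d)(f); index typed
by abc-iut-L5-t2 `ThetaGeometry.PiXbar_relIndex`).  The kit's `toFlStar (nY)` is the class in `𝔽_l^⋇` of the
EXPONENT by which `n` acts by conjugation on `X/Y ≅ ℤ/l`.  This file supplies that exponent without any
definition (so that the post-freeze defs `conjSubquot` / `toFlStarOfNormalizer` of the next window are one-liners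
whose proof obligations are already discharged):

* §3 (L1) `exists_unique_units_pow_eq_of_injective` / `exists_unique_units_pow_eq`: an injective endomorphism
  (automorphism) of a group of prime order `l` is `q ↦ q^u` for a UNIQUE `u ∈ (ℤ/l)^×` (canonical: no generator
  chosen); `pow_units_val_mul` / `pow_units_val_one` / `units_pow_eq_self_iff` (exponents multiply; `u = 1` iff
  trivial);
* §4 (L2) `exists_unique_conj_pow_mem`: for `n` normalising `X` and `Y` a UNIQUE unit `u` with
  `n k n⁻¹ ≡ k^u (mod Y)` for all `k ∈ X`; (L2a/b) `conj_pow_mem_of_mem`: `u = 1` for `n ∈ X` (inner automorphisms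
  are trivial on the ABELIAN quotient), `conj_pow_mem_mul` (multiplicative in `n` — a homomorphism into the abelian
  `(ℤ/l)^×`, so the `ᵒᵖ` in `Aut(A/Y) = (N_A(Y)/Y)ᵒᵖ` is immaterial), `conj_pow_mem_mul_of_mem` (constant on
  `X`-cosets, a fortiori on the `Y`-cosets of `OrbitCat.autOfNormalizer_eq_iff`), `conj_pow_mem_one_iff` (kernel =
  the centraliser of `X/Y`).  SURJECTIVITY onto `𝔽_l^⋇` is NOT group theory (Def 3.1 (c), split torus of
  `SL₂(𝔽_l)`) and stays with the binding (criterion: `FlStar.mk'_comp_surjective_iff` in the companion file).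

Proof-only (0 definitions, no instance, no notation, no `Prop` fact); pure Mathlib group theory.
typed ≠ proved elsewhere.
-/

namespace Literature.IUT.HodgeTheaters

/-! ### §3 (L1) Automorphisms of a group of prime order `l` are `q ↦ q^u`, `u ∈ (ℤ/l)^×` canonical -/

section PrimeOrder

variable {l : ℕ} [hp : Fact l.Prime] {Q : Type*} [Group Q]

/-- **(L1)** For a group `Q` of prime order `l` (the rank one quotient `Δ_X^{ab} ⊗ 𝔽_l ↠ Q`, `Gal(X̲_K/X_K)`) and an
INJECTIVE endomorphism `φ` there is a UNIQUE unit `u ∈ (ℤ/l)^×` with `φ q = q^u` for all `q` — canonical,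
independent of any generator ([IUTchI] Def 6.1 (v) p.158: the action on the rank one quotient is a scalar).
([IUTchI] Def 6.1 (v) p.158) [claim: Mochizuki2012, status: disputed] -/
theorem exists_unique_units_pow_eq_of_injective (hQ : Nat.card Q = l) (φ : Q →* Q)
    (hφ : Function.Injective φ) :
    ∃! u : (ZMod l)ˣ, ∀ q : Q, φ q = q ^ (u : ZMod l).val := by
  haveI : NeZero l := ⟨hp.out.ne_zero⟩
  haveI : Finite Q := Nat.finite_of_card_ne_zero (hQ ▸ hp.out.ne_zero)
  haveI : Nontrivial Q := Finite.one_lt_card_iff_nontrivial.mp (hQ ▸ hp.out.one_lt)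
  obtain ⟨g, hg⟩ : ∃ g : Q, g ≠ 1 := exists_ne 1
  -- `φ g` is a power `g ^ e`
  obtain ⟨e, he⟩ := (Submonoid.mem_powers_iff _ _).mp (mem_powers_of_prime_card hQ hg (g' := φ g))
  -- `e` is prime to `l`
  have hel : ¬ l ∣ e := by
    rintro ⟨m, rfl⟩
    have : φ g = 1 := by rw [← he, pow_mul, ← hQ, pow_card_eq_one', one_pow]
    exact hg (hφ (by rw [this, map_one]))
  have hcop : Nat.Coprime e l := ((Nat.Prime.coprime_iff_not_dvd hp.out).mpr hel).symm
  have hpow : ∀ q : Q, φ q = q ^ e := by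
    intro q
    obtain ⟨i, rfl⟩ := (Submonoid.mem_powers_iff _ _).mp (mem_powers_of_prime_card hQ hg (g' := q))
    rw [map_pow, ← he, ← pow_mul, ← pow_mul, mul_comm]
  have hmod : ∀ (q : Q) (n : ℕ), q ^ (n % l) = q ^ n := fun q n => by
    have h := pow_mod_natCard q n
    rwa [hQ] at h
  refine ⟨ZMod.unitOfCoprime e hcop, fun q => ?_, fun v hv => ?_⟩
  · rw [ZMod.coe_unitOfCoprime, ZMod.val_natCast, hmod, hpow]
  · -- uniqueness: compare on the generator `g`, of order `l`
    apply Units.ext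
    have hord : orderOf g = l := by
      rw [← hQ]
      exact orderOf_eq_card_of_forall_mem_powers fun x => mem_powers_of_prime_card hQ hg
    have h1 : g ^ (v : ZMod l).val = g ^ ((ZMod.unitOfCoprime e hcop : (ZMod l)ˣ) : ZMod l).val := by
      rw [← hv g, ZMod.coe_unitOfCoprime, ZMod.val_natCast, hmod, hpow]
    rw [pow_inj_mod, hord, Nat.mod_eq_of_lt (ZMod.val_lt _), Nat.mod_eq_of_lt (ZMod.val_lt _)] at h1
    exact ZMod.val_injective l h1

/-- **(L1)** for automorphisms: `MulAut Q ∋ φ ↦` the unique unit `u` with `φ = (· ^ u)` (the canonical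
`MulAut Q → (ℤ/l)^×`, an isomorphism; cf. Mathlib `IsCyclic.mulAutMulEquiv`).
([IUTchI] Def 6.1 (v) p.158) [claim: Mochizuki2012, status: disputed] -/
theorem exists_unique_units_pow_eq (hQ : Nat.card Q = l) (φ : Q ≃* Q) :
    ∃! u : (ZMod l)ˣ, ∀ q : Q, φ q = q ^ (u : ZMod l).val :=
  exists_unique_units_pow_eq_of_injective hQ φ.toMonoidHom φ.injective

omit hp in
/-- Exponents multiply: `q^{uv} = (q^u)^v` in a group of order `l` (the exponent map is a homomorphism).
([IUTchI] Def 6.1 (v) p.158) [claim: Mochizuki2012, status: disputed] -/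
theorem pow_units_val_mul (hQ : Nat.card Q = l) (q : Q) (u v : (ZMod l)ˣ) :
    q ^ ((u * v : (ZMod l)ˣ) : ZMod l).val = (q ^ (u : ZMod l).val) ^ (v : ZMod l).val := by
  rw [← pow_mul, Units.val_mul, ZMod.val_mul]
  have h := pow_mod_natCard q ((u : ZMod l).val * (v : ZMod l).val)
  rwa [hQ] at h

/-- The exponent `1` is the identity. ([IUTchI] Def 6.1 (v) p.158) [claim: Mochizuki2012, status: disputed] -/
theorem pow_units_val_one (q : Q) : q ^ ((1 : (ZMod l)ˣ) : ZMod l).val = q := by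
  haveI : Fact (1 < l) := ⟨hp.out.one_lt⟩
  rw [Units.val_one, ZMod.val_one, pow_one]

/-- In a group of prime order `l`, `q ↦ q^u` is the identity iff `u = 1`.
([IUTchI] Def 6.1 (v) p.158) [claim: Mochizuki2012, status: disputed] -/
theorem units_pow_eq_self_iff (hQ : Nat.card Q = l) (u : (ZMod l)ˣ) :
    (∀ q : Q, q ^ (u : ZMod l).val = q) ↔ u = 1 := by
  constructor
  · intro h
    obtain ⟨w, -, huniq⟩ := exists_unique_units_pow_eq_of_injective hQ (MonoidHom.id Q)
      Function.injective_id
    have h1 : u = w := huniq u fun q => (h q).symm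
    have h2 : (1 : (ZMod l)ˣ) = w := huniq 1 fun q => (pow_units_val_one q).symm
    rw [h1, ← h2]
  · rintro rfl q
    exact pow_units_val_one q

end PrimeOrder

/-! ### §4 (L2a/b) The exponent of a normalising element on a prime-index subquotient `X / Y`

Setting of the instance (abc-iut-L5-t4 P5): `A = Π_{C_F}`, `Y = Π_{X̲_K} ≤ X = Π_{X_K}` with `Y ⊴ X` of index `l`
(the covering `X̲_K → X_K`, [IUTchI] Def 3.1 (d)/(f)); automorphisms of `𝒟^{⊚±} = ℬ(Y)⁰` over the ambient are the
cosets `nY`, `n ∈ N_A(Y)` (`OrbitCat.exists_eq_autOfNormalizer`). -/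

section Subquotient

variable {A : Type*} [Group A] {Y X : Subgroup A} {l : ℕ} [hp : Fact l.Prime]

/-- **The exponent of a normalising element, def-free**: for `Y ≤ X`, `Y ⊴ X` of prime index `l`, and `n`
normalising both `X` and `Y`, there is a UNIQUE unit `u ∈ (ℤ/l)^×` such that `n k n⁻¹ ≡ k^u (mod Y)` for every
`k ∈ X` — the scalar by which `n` acts on the rank one quotient `X/Y ≅ ℤ/l` ([IUTchI] Def 6.1 (v) p.158; the kit's
`toFlStar n` is its class in `𝔽_l^⋇`). ([IUTchI] Def 6.1 (v) p.158) [claim: Mochizuki2012, status: disputed] -/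
theorem exists_unique_conj_pow_mem (hYX : Y ≤ X) [hN : (Y.subgroupOf X).Normal]
    (hidx : Y.relIndex X = l) {n : A} (hnX : n ∈ Subgroup.normalizer (X : Set A))
    (hnY : n ∈ Subgroup.normalizer (Y : Set A)) :
    ∃! u : (ZMod l)ˣ, ∀ k ∈ X, (k ^ (u : ZMod l).val)⁻¹ * (n * k * n⁻¹) ∈ Y := by
  have _ := hYX
  -- the quotient `Q = X / Y` has prime order `l`
  have hQ : Nat.card (X ⧸ Y.subgroupOf X) = l := hidx
  have hmemX : ∀ k : X, n * k * n⁻¹ ∈ X := fun k =>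
    (Subgroup.mem_normalizer_iff.mp hnX k).mp k.2
  -- conjugation by `n` as a homomorphism `X →* X / Y`
  let c : X →* X ⧸ Y.subgroupOf X :=
    { toFun := fun k => QuotientGroup.mk ⟨n * k * n⁻¹, hmemX k⟩
      map_one' := by
        rw [← QuotientGroup.mk_one]
        congr 1
        exact Subtype.ext (by simp)
      map_mul' := fun a b => by
        rw [← QuotientGroup.mk_mul]
        congr 1
        exact Subtype.ext (by simp [mul_assoc]) }
  have hc : ∀ k : X, c k = QuotientGroup.mk ⟨n * k * n⁻¹, hmemX k⟩ := fun k => rfl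
  have hker : Y.subgroupOf X ≤ c.ker := by
    intro y hy
    rw [Subgroup.mem_subgroupOf] at hy
    rw [MonoidHom.mem_ker, hc, QuotientGroup.eq_one_iff, Subgroup.mem_subgroupOf]
    exact (Subgroup.mem_normalizer_iff.mp hnY y).mp hy
  -- it descends to an injective endomorphism `φ` of `Q`
  let φ : X ⧸ Y.subgroupOf X →* X ⧸ Y.subgroupOf X := QuotientGroup.lift _ c hker
  have hφ : ∀ k : X, φ (QuotientGroup.mk k) = QuotientGroup.mk ⟨n * k * n⁻¹, hmemX k⟩ :=
    fun k => rfl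
  have hφinj : Function.Injective φ := by
    rw [injective_iff_map_eq_one]
    intro q hq
    induction q using QuotientGroup.induction_on with
    | H k =>
      rw [hφ, QuotientGroup.eq_one_iff, Subgroup.mem_subgroupOf] at hq
      rw [QuotientGroup.eq_one_iff, Subgroup.mem_subgroupOf]
      exact (Subgroup.mem_normalizer_iff.mp hnY k).mpr hq
  obtain ⟨u, hu, huniq⟩ := exists_unique_units_pow_eq_of_injective hQ φ hφinj
  -- translate `φ (kY) = (kY)^v` into the membership statement
  have key : ∀ (v : (ZMod l)ˣ) (k : X),
      (φ (QuotientGroup.mk k) = (QuotientGroup.mk k) ^ (v : ZMod l).val ↔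
        ((k : A) ^ (v : ZMod l).val)⁻¹ * (n * k * n⁻¹) ∈ Y) := by
    intro v k
    rw [hφ, ← QuotientGroup.mk_pow, eq_comm, QuotientGroup.eq, Subgroup.mem_subgroupOf,
      Subgroup.coe_mul, Subgroup.coe_inv, Subgroup.coe_pow]
  refine ⟨u, fun k hk => (key u ⟨k, hk⟩).mp (hu _), fun v hv => huniq v fun q => ?_⟩
  induction q using QuotientGroup.induction_on with
  | H k => exact (key v k).mpr (hv k k.2)

/-- **(L2a/b)** Elements of `X` (in particular of `Y`) have exponent `1`: inner automorphisms act trivially on the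
ABELIAN quotient `X/Y` (prime order ⇒ cyclic) — so the exponent descends to `N/(N ∩ X)` and is constant on the
`Y`-cosets that parametrise `Aut(ℬ(Y)⁰)` (`OrbitCat.autOfNormalizer_eq_iff`).
([IUTchI] Def 6.1 (v) p.158) [claim: Mochizuki2012, status: disputed] -/
theorem conj_pow_mem_of_mem (hYX : Y ≤ X) [hN : (Y.subgroupOf X).Normal]
    (hidx : Y.relIndex X = l) {n : A} (hn : n ∈ X) :
    ∀ k ∈ X, (k ^ ((1 : (ZMod l)ˣ) : ZMod l).val)⁻¹ * (n * k * n⁻¹) ∈ Y := by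
  have _ := hYX
  intro k hk
  have hQ : Nat.card (X ⧸ Y.subgroupOf X) = l := hidx
  haveI := isCyclic_of_prime_card hQ
  haveI : IsMulCommutative (X ⧸ Y.subgroupOf X) := IsCyclic.isMulCommutative
  have hcomm : ∀ a b : X ⧸ Y.subgroupOf X, a * b = b * a := fun a b =>
    IsMulCommutative.is_comm.comm a b
  rw [pow_units_val_one]
  -- the commutator `k⁻¹ (n k n⁻¹)` dies in the abelian quotient `X / Y`
  have hmem : ((⟨k, hk⟩ : X)⁻¹ * ((⟨n, hn⟩ : X) * ⟨k, hk⟩ * (⟨n, hn⟩ : X)⁻¹)) ∈ Y.subgroupOf X := by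
    rw [← QuotientGroup.eq_one_iff]
    simp only [QuotientGroup.mk_mul, QuotientGroup.mk_inv]
    rw [hcomm (QuotientGroup.mk (⟨n, hn⟩ : X)) (QuotientGroup.mk (⟨k, hk⟩ : X)), mul_inv_cancel_right,
      inv_mul_cancel]
  rw [Subgroup.mem_subgroupOf] at hmem
  simpa using hmem

omit hp in
/-- **Exponents multiply**: if `n` acts on `X/Y` by `u` and `m` by `v` (both normalising `X` and `Y`), then `n m` acts
by `u v` — the exponent is a homomorphism `N_A(X) ⊓ N_A(Y) → (ℤ/l)^×` (into an ABELIAN group, so the order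
reversal `Aut(A/Y) = (N_A(Y)/Y)^{op}` of right multiplications is immaterial).
([IUTchI] Def 6.1 (v) p.158) [claim: Mochizuki2012, status: disputed] -/
theorem conj_pow_mem_mul (hYX : Y ≤ X) [hN : (Y.subgroupOf X).Normal]
    (hidx : Y.relIndex X = l) {n m : A} (hnX : n ∈ Subgroup.normalizer (X : Set A))
    (hnY : n ∈ Subgroup.normalizer (Y : Set A)) {u v : (ZMod l)ˣ}
    (hu : ∀ k ∈ X, (k ^ (u : ZMod l).val)⁻¹ * (n * k * n⁻¹) ∈ Y)
    (hv : ∀ k ∈ X, (k ^ (v : ZMod l).val)⁻¹ * (m * k * m⁻¹) ∈ Y) :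
    ∀ k ∈ X, (k ^ ((u * v : (ZMod l)ˣ) : ZMod l).val)⁻¹ * (n * m * k * (n * m)⁻¹) ∈ Y := by
  intro k hk
  have hQ : Nat.card (X ⧸ Y.subgroupOf X) = l := hidx
  have hmkX : m * k * m⁻¹ ∈ X := by
    have h2 := X.mul_mem (X.pow_mem hk (v : ZMod l).val) (hYX (hv k hk))
    simpa [mul_assoc] using h2
  -- (1) `m k m⁻¹ ≡ k^v` in `Q = X / Y`
  have e1 : (QuotientGroup.mk (⟨m * k * m⁻¹, hmkX⟩ : X) : X ⧸ Y.subgroupOf X) =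
      (QuotientGroup.mk (⟨k, hk⟩ : X)) ^ (v : ZMod l).val := by
    rw [← QuotientGroup.mk_pow, eq_comm, QuotientGroup.eq, Subgroup.mem_subgroupOf]
    simpa using hv k hk
  -- (2) conjugation by `n` is a homomorphism `X → X/Y` killing `Y`, so it respects (1)
  have hmemX : ∀ k : X, n * k * n⁻¹ ∈ X := fun k =>
    (Subgroup.mem_normalizer_iff.mp hnX k).mp k.2
  let c : X →* X ⧸ Y.subgroupOf X :=
    { toFun := fun k => QuotientGroup.mk ⟨n * k * n⁻¹, hmemX k⟩
      map_one' := by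
        rw [← QuotientGroup.mk_one]
        congr 1
        exact Subtype.ext (by simp)
      map_mul' := fun a b => by
        rw [← QuotientGroup.mk_mul]
        congr 1
        exact Subtype.ext (by simp [mul_assoc]) }
  have hc : ∀ k : X, c k = QuotientGroup.mk ⟨n * k * n⁻¹, hmemX k⟩ := fun k => rfl
  have hker : Y.subgroupOf X ≤ c.ker := by
    intro y hy
    rw [Subgroup.mem_subgroupOf] at hy
    rw [MonoidHom.mem_ker, hc, QuotientGroup.eq_one_iff, Subgroup.mem_subgroupOf]
    exact (Subgroup.mem_normalizer_iff.mp hnY y).mp hy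
  let φ : X ⧸ Y.subgroupOf X →* X ⧸ Y.subgroupOf X := QuotientGroup.lift _ c hker
  have hφ : ∀ k : X, φ (QuotientGroup.mk k) = QuotientGroup.mk ⟨n * k * n⁻¹, hmemX k⟩ :=
    fun k => rfl
  have hφu : ∀ k : X, φ (QuotientGroup.mk k) = (QuotientGroup.mk k) ^ (u : ZMod l).val := by
    intro k
    rw [hφ, ← QuotientGroup.mk_pow, eq_comm, QuotientGroup.eq, Subgroup.mem_subgroupOf]
    simpa using hu k k.2
  have e2 : φ (QuotientGroup.mk (⟨m * k * m⁻¹, hmkX⟩ : X)) =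
      ((QuotientGroup.mk (⟨k, hk⟩ : X)) ^ (u : ZMod l).val) ^ (v : ZMod l).val := by
    rw [e1, map_pow, hφu]
  rw [hφ, ← pow_units_val_mul hQ, ← QuotientGroup.mk_pow, eq_comm, QuotientGroup.eq,
    Subgroup.mem_subgroupOf] at e2
  simpa [mul_assoc] using e2

/-- Hence the exponent is CONSTANT ON `X`-COSETS (a fortiori on `Y`-cosets): `n` and `n x`, `x ∈ X`, act on `X/Y`
by the same unit — compatible with `Aut(A/Y) = N_A(Y)/Y` (`OrbitCat.autOfNormalizer_eq_iff`).
([IUTchI] Def 6.1 (v) p.158) [claim: Mochizuki2012, status: disputed] -/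
theorem conj_pow_mem_mul_of_mem (hYX : Y ≤ X) [hN : (Y.subgroupOf X).Normal]
    (hidx : Y.relIndex X = l) {n x : A} (hnX : n ∈ Subgroup.normalizer (X : Set A))
    (hnY : n ∈ Subgroup.normalizer (Y : Set A)) (hx : x ∈ X) {u : (ZMod l)ˣ}
    (hu : ∀ k ∈ X, (k ^ (u : ZMod l).val)⁻¹ * (n * k * n⁻¹) ∈ Y) :
    ∀ k ∈ X, (k ^ (u : ZMod l).val)⁻¹ * (n * x * k * (n * x)⁻¹) ∈ Y := by
  have h := conj_pow_mem_mul hYX hidx hnX hnY hu (conj_pow_mem_of_mem hYX hidx hx)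
  rwa [mul_one] at h

/-- The exponent of `n` is `1` iff `n` CENTRALISES `X/Y` (`n k n⁻¹ ≡ k`): the kernel of the exponent character.
([IUTchI] Def 6.1 (v) p.158) [claim: Mochizuki2012, status: disputed] -/
theorem conj_pow_mem_one_iff (hYX : Y ≤ X) [hN : (Y.subgroupOf X).Normal]
    (hidx : Y.relIndex X = l) {n : A} (hnX : n ∈ Subgroup.normalizer (X : Set A))
    (hnY : n ∈ Subgroup.normalizer (Y : Set A)) {u : (ZMod l)ˣ}
    (hu : ∀ k ∈ X, (k ^ (u : ZMod l).val)⁻¹ * (n * k * n⁻¹) ∈ Y) :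
    u = 1 ↔ ∀ k ∈ X, k⁻¹ * (n * k * n⁻¹) ∈ Y := by
  obtain ⟨w, -, huniq⟩ := exists_unique_conj_pow_mem hYX hidx hnX hnY
  constructor
  · rintro rfl k hk
    simpa only [pow_units_val_one] using hu k hk
  · intro h
    have h1 : ∀ k ∈ X, (k ^ ((1 : (ZMod l)ˣ) : ZMod l).val)⁻¹ * (n * k * n⁻¹) ∈ Y := fun k hk => by
      simpa only [pow_units_val_one] using h k hk
    rw [huniq u hu, huniq 1 h1]

end Subquotient

end Literature.IUT.HodgeTheaters
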